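import Summits.BirchSwinnertonDyer.BirchSwinnertonDyer.Theorems.SchneiderFreeAdditiveX3PoitouTateReciprocityEquality
import Summits.BirchSwinnertonDyer.BirchSwinnertonDyer.Theorems.SchneiderFreeAdditiveX3PoitouTateShaDualOfR4A
import Summits.BirchSwinnertonDyer.BirchSwinnertonDyer.Theorems.SchneiderFreeAdditiveX3PoitouTateReciprocitySumHolds
import Summits.BirchSwinnertonDyer.BirchSwinnertonDyer.Theorems.ThetaPartnerAtTwoSignedControlAtTwoMuRealUnramifiedAE
import Literature.NumberTheory.GaloisRepresentations.HomDualReadoutUnramified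
import HarnessLib

/-!
# The (R4) reciprocity equality HOLDS (input `hRur` discharged); PT2 `poitouTate_sha_tateDual K` for totally complex `K`
# from the degree-2 input (A) ALONE (Milne *ADT* I Thm. 4.10 (a), proof p. 58; Lemma 4.13)

Cell `bsd-schneider`, seat `door-c5` g18.  Crux `stmt-BirchSwinnertonDyer-19295` `AnticycControlAdditiveK` (⟸ PT2 alone, door-c4
`anticycControlAdditiveK_of_sha_tateDual`; PT2 = bsd-wall item 20462).  Theorems only; no definition, no named fact, no instance, no `sorry`.

* **`hRur_holds`** — the one named input of `hR4_ideleProjection_of_readoutUnramified` (door-c5, `…ReciprocityEquality`): for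
  `f : N₁ ⟶ J̄` a finite `Tf ⊆ Place K` off which `v ∤ n`, `M^D` is unramified and the readout `R_v f` is unramified —
  `HomDual.exists_finset_forall_readout_mem_unramifiedSubgroup` (door-c5, `HomDualReadoutUnramified`: Smith-normal-form extension over
  `K_v^{nr}`, roots of unramified units) ∪ `exists_finset_place_isUnramifiedAt` for `M` and for `M^D` (bsd-wall K4).
* **`hR4_ideleProjection`** — VERBATIM the binder `hR4` of door-c4's `poitouTate_sha_tateDual_of_R4_A` / bsd-wall k4-p1's
  `poitouTate_sha_tateDual_of_bridge_of_localGlobal`: `∃ nat, Bijective nat ∧ (R4=)` at every level `n`, every finite `n`-torsion `M`,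
  for THE idèle projections and THE canonical invariant maps, EVERY number field `K` — with `nat := −(Φ⁻¹ ∘ H¹(κ))`
  (`nat_bijective`, `(ι, κ)` from `exists_bidual_intertwining`).
* **`poitouTate_sha_tateDual_of_A`** — for `K` totally complex, PT2 from the degree-`2` input (A) ALONE
  (`poitouTate_sha_tateDual_of_R4_A` with `hcomp := selmerComplement_canonical_holds`, `hR4 := hR4_ideleProjection`; (B) is door-c5's
  `sha_hom_units_dies_in_idele`, plugged there).

HONEST FRAMING: assembly of tree theorems; (A) — the vanishing of `Ш²`-classes of `M^D ≅ Hom(M, K̄ˣ)` in `H²(K, Hom(P, K̄ˣ))` along the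
canonical presentation (bsd-wall chl-p2's lane) — remains a GENUINE open input here; no case of Poitou–Tate (a) or of BSD is proved
unconditionally in this file.

## References
* J. S. Milne, *Arithmetic Duality Theorems* (2nd ed. 2006), I Thm. 4.10 (a) and its proof (p. 58), Lemma 4.13, Prop. 0.19. [MilneADT2006]
* J. W. S. Cassels, A. Fröhlich (eds.), *Algebraic Number Theory* (1967), Ch. VII (Tate) §11.2 (bis), §7.3. [CasselsFrohlichANT1967]
-/

noncomputable section

open Function NumberField IsDedekindDomain CategoryTheory CategoryTheory.Abelian groupCohomology
open scoped NumberField ContRepresentation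

set_option linter.dupNamespace false
set_option autoImplicit false

namespace Summit.BirchSwinnertonDyer.BirchSwinnertonDyer.Theorems.SchneiderFreeAdditiveX3.PoitouTateReduction

open Field
open Literature.NumberTheory.GaloisRepresentations Literature.NumberTheory.GaloisCohomology
open Literature.NumberTheory.GaloisRepresentations.DiscreteGaloisModule (TateDual tateDual localTatePairingZMod
  unramifiedSubgroup sha shaTwo)
open Literature.Algebra.Homology Literature.Algebra.Homology.DiscreteRep Literature.Algebra.Homology.ExtPresentation
open Literature.NumberTheory.GaloisRepresentations.IdeleClassBar (classBarD classBarInv)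
open Literature.AnabelianGeometry.AbsoluteAnabelian.Prop121vii (zmodToQmodZ)
open Literature.NumberTheory.GaloisRepresentations.FreePresentation (presentationComplex presentationComplex_shortExact
  presModule₁ presModule₂ presProj moduleFinite_presModule₁ moduleFinite_presModule₂)
open Literature.NumberTheory.GaloisRepresentations.HomDual (IdeleProjection readout dualF
  exists_finset_forall_readout_mem_unramifiedSubgroup)
open Literature.NumberTheory.GaloisRepresentations.IdeleReadout (ideleProjection)
open Literature.NumberTheory.GaloisRepresentations.DiscreteGaloisModule (units)
open Literature.NumberTheory.GaloisRepresentations.OpenLayer (extOneEquiv)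
open Summit.BirchSwinnertonDyer.Rank1Residual.GaloisImage.UnramifiedCup (isUnit_natCast_integer_of_not_mem)
open Summit.BirchSwinnertonDyer.BirchSwinnertonDyer.Theorems.SignedEC.MuReal (exists_finset_place_isUnramifiedAt)

variable {K : Type} [Field K] [NumberField K]

/-- **`hRur` HOLDS**: for `f : N₁ ⟶ J̄` there is a finite set of places off which `v ∤ n`, `M^D` is unramified at `v`, and the
readout `readout ρ₀ n hM π_v f` is unramified (the named input of `hR4_ideleProjection_of_readoutUnramified`).
[cite: MilneADT2006, I Lemma 4.13 (proof), I §4][cite: SerreAbelianLadic1968, Ch. I §2.1] -/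
theorem hRur_holds {n : ℕ} [NeZero n]
    {M : Type} [AddCommGroup M] [TopologicalSpace M] [DiscreteTopology M] [Finite M] [Finite (TateDual K M n)]
    (ρ₀ : DiscreteGaloisModule K M) (hM : ∀ m : M, n • m = 0)
    (f : (presentationComplex ρ₀).X₁ ⟶ (ideleClassLimitShortComplex K).X₂) :
    ∃ Tf : Finset (Place K), ∀ v : HeightOneSpectrum (𝓞 K), (Sum.inr v : Place K) ∉ Tf →
      ((n : ℕ) : 𝓞 K) ∉ v.asIdeal ∧ GaloisRep.IsUnramifiedAt v (ρ₀.tateDual n) ∧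
        readout ρ₀ n hM (ideleProjection K (Sum.inr v)) f ∈
          unramifiedSubgroup (GaloisRep.toLocal v (ρ₀.tateDual n)) 1 := by
  classical
  obtain ⟨T, hT⟩ := exists_finset_forall_readout_mem_unramifiedSubgroup ρ₀ n hM f
  obtain ⟨S₀, -, hS₀⟩ := exists_finset_place_isUnramifiedAt ρ₀ n
  obtain ⟨S₁, -, hS₁⟩ := exists_finset_place_isUnramifiedAt (ρ₀.tateDual n) n
  refine ⟨S₀ ∪ S₁ ∪ T.image Sum.inr, fun v hv => ?_⟩
  have hv₀ : (Sum.inr v : Place K) ∉ S₀ := fun h => hv (Finset.mem_union_left _ (Finset.mem_union_left _ h))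
  have hv₁ : (Sum.inr v : Place K) ∉ S₁ := fun h => hv (Finset.mem_union_left _ (Finset.mem_union_right _ h))
  have hvT : v ∉ T := fun h => hv (Finset.mem_union_right _ (Finset.mem_image_of_mem _ h))
  exact ⟨(hS₀ v hv₀).1, (hS₁ v hv₁).2,
    hT v hvT (isUnit_natCast_integer_of_not_mem n v (hS₀ v hv₀).1) (hS₀ v hv₀).2⟩

/-- **The (R4) reciprocity equality with a bijective bridge, for THE idèle projections and THE canonical invariant maps** —
VERBATIM the hypothesis `hR4` of `poitouTate_sha_tateDual_of_R4_A` (and of bsd-wall's `poitouTate_sha_tateDual_of_bridge_of_localGlobal`),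
at every level `n ≥ 1` and every finite `n`-torsion `M`, for every number field `K`; `nat := −(Φ⁻¹ ∘ H¹(κ))` with door-c5's
inflation bijection `Φ = OpenLayer.extOneEquiv ρ₀` and a biduality pair `(ι, κ)`.
[cite: MilneADT2006, I Thm. 4.10 (a) (proof, p. 58), Lemma 4.13, Prop. 0.19][cite: CasselsFrohlichANT1967, Ch. VII §11.2 (bis)] -/
theorem hR4_ideleProjection (n : ℕ) [NeZero n]
    ⦃M : Type⦄ [AddCommGroup M] [TopologicalSpace M] [DiscreteTopology M] [Finite M] [Finite (TateDual K M n)]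
    (ρ₀ : DiscreteGaloisModule K M) (hM : ∀ m : M, n • m = 0) :
    ∃ nat : galoisCohomology ((ρ₀.tateDual n).tateDual n) 1 →+
        Abelian.Ext (triv (Γ := absoluteGaloisGroup K) ℤ) (presentationComplex ρ₀).X₃ 1,
      Function.Bijective nat ∧
      ∀ f : (presentationComplex ρ₀).X₁ ⟶ (ideleClassLimitShortComplex K).X₂, ∃ Tf : Finset (Place K),
        ∀ (y : galoisCohomology ((ρ₀.tateDual n).tateDual n) 1) (T' : Finset (Place K)), Tf ⊆ T' →
          (∀ v : HeightOneSpectrum (𝓞 K), (Sum.inr v : Place K) ∉ T' →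
            galoisCohomology.localization ((ρ₀.tateDual n).tateDual n) (Sum.inr v) 1 y ∈
              unramifiedSubgroup (GaloisRep.toLocal v ((ρ₀.tateDual n).tateDual n)) 1) →
          zmodToQmodZ n (∑ v ∈ T', localTatePairingZMod (ρ₀.tateDual n) n v (LocalInvariants.canonical K n v)
            (readout ρ₀ n hM (ideleProjection K v) f)
            (galoisCohomology.localization ((ρ₀.tateDual n).tateDual n) v 1 y)) =
          classBarInv K ((nat y).comp (boundary (presentationComplex_shortExact ρ₀) (classBarD K)
            (f ≫ (ideleClassLimitShortComplex K).g)) (rfl : 1 + 1 = 2)) := by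
  obtain ⟨ι, κ, hι, hκι, hικ⟩ := exists_bidual_intertwining (n := n) ρ₀ hM
  exact ⟨-((AddMonoidHom.id (Abelian.Ext (triv (Γ := absoluteGaloisGroup K) ℤ) (presentationComplex ρ₀).X₃ 1)).comp
      (((extOneEquiv ρ₀).symm.toAddMonoidHom).comp (galoisCohomology.map κ 1))),
    nat_bijective ρ₀ ι κ hκι hικ,
    hR4_ideleProjection_of_readoutUnramified ρ₀ hM ι κ hι hκι hικ (hRur_holds ρ₀ hM)⟩

/-- **PT2 `poitouTate_sha_tateDual K` for totally complex `K` from the degree-`2` input (A) ALONE**: door-c4's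
`poitouTate_sha_tateDual_of_R4_A` with `hcomp := selmerComplement_canonical_holds` (door-c4) and `hR4 := hR4_ideleProjection` (door-c5);
(B) = door-c5's `sha_hom_units_dies_in_idele` is plugged inside.  HONEST FRAMING: (A) is a genuine remaining input (bsd-wall chl-p2).
[cite: MilneADT2006, I Thm. 4.10 (a) (proof, p. 58), Lemma 4.13][cite: Harari2020, Thm. 17.13 (b)] -/
theorem poitouTate_sha_tateDual_of_A [IsTotallyComplex K]
    (hA : ∀ (n : ℕ) [NeZero n],
      ∀ ⦃M : Type⦄ [AddCommGroup M] [TopologicalSpace M] [DiscreteTopology M] [Finite M]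
      (ρ₀ : DiscreteGaloisModule K M) (hM : ∀ m : M, n • m = 0),
        haveI := moduleFinite_presModule₂ ρ₀
        ∀ c ∈ shaTwo (ρ₀.tateDual n),
          cohomologyMap (dualF (presModule₂ ρ₀) ρ₀ (units K) (presProj ρ₀)) 2
            (cohomologyMap (HomDual.tateDualUnitsIso K ρ₀ n hM).hom 2 c) = 0) :
    poitouTate_sha_tateDual K :=
  poitouTate_sha_tateDual_of_R4_A (fun n _ => selmerComplement_canonical_holds K n)
    (fun n _ _ _ _ _ _ _ ρ₀ hM => hR4_ideleProjection n ρ₀ hM) hA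

end Summit.BirchSwinnertonDyer.BirchSwinnertonDyer.Theorems.SchneiderFreeAdditiveX3.PoitouTateReduction

end
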